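import Summits.ResolutionOfSingularities.ResolutionOfSingularities.Theorems.WeightedInvariantHypersurfaceCentreAlgebraize
import Summits.ResolutionOfSingularities.ResolutionOfSingularities.Theorems.WeightedInvariantIota3FlagTools
import Summits.ResolutionOfSingularities.ResolutionOfSingularities.Theorems.WeightedInvariantP3bDrop
import HarnessLib

/-!
# The flag ⟷ weighted-monomial BRIDGE: `flagContactFiltration g₁ g₂ q r₁ r₂ = 𝒥((x, g₂, g₁); (q, r₂, r₁))`

Topic: `Summits/ResolutionOfSingularities/ResolutionOfSingularities/Theorems`. Helper for the door item
`HypersurfaceCentreConstruction` (statement `stmt-ResolutionOfSingularities-19897`, route `WeightedInvariant`), line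
`local-engine` of res-L1-w43-plan-1 (L W4.3), P3 rung, J₃/σ side of IOTA3-DESIGN v1.3 (RULING gen 11 #2): res-type-073's
letters σ and res-type-061's `Iota3.IsSigmaMaximiser` / `jSigmaPt` are written with the CHOICE-FREE two-flag filtration
`flagContactFiltration g₁ g₂ q r₁ r₂ n = ⨆_{α β} (g₁^α g₂^β)·𝔪^⌈(n − r₁α − r₂β)/q⌉` (p528355), while every (drop) statement
(`WeightedDrop ι S f 𝔪 ![x, g₂, g₁] ![q, r₂, r₁]`, `…P3bDrop` p529577) and every piece of cobordant-blow-up plumbing in the tree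
runs on the weighted monomial ideals `weightedMonomialIdeal u w n` of a full system `u = (x, g₂, g₁)`.  This file identifies
the two.

[OURS · L1 W4.3] Replaces the role of NO printed item; NOT a statement of the manuscript
[claim: Hironaka2017, status: under-review]. AI work, weaker than expert review. Def-free; nothing here asserts any clause of the KEY.

## Content (namespace `…LocalEngine.Iota3`)

* (B3) the `IdealFiltration` axioms of the choice-free filtration itself (no completing parameter): `flagContactFiltration_zero`
  (`= ⊤`), `flagContactFiltration_antitone`, **`flagContactFiltration_mul_le : F a * F b ≤ F (a + b)`** (ceiling subadditivity).
* (B1) **`flagContactFiltration_eq_weightedMonomialIdeal`**: if `Ideal.span {x, g₂, g₁} = 𝔪` and `0 < q ≤ r₂`, `q ≤ r₁`, then for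
  every `n`, `flagContactFiltration g₁ g₂ q r₁ r₂ n = weightedMonomialIdeal ![x, g₂, g₁] ![q, r₂, r₁] n` — in ANY local ring and for
  ANY completing generator `x` (no regularity): `⊆` piece by piece (`(g₁^α g₂^β) ∈ 𝒥_{r₁α+r₂β}`, `𝔪ᵏ ⊆ 𝒥_{qk}` since every weight
  is `≥ q`, multiplicativity, `q⌈a/q⌉ ≥ a`); `⊇` generator by generator (`x^a g₂^b g₁^c` with `qa + r₂b + r₁c ≥ n` lies in the piece
  `(c, b)`, res-type-070's `mul_mem_flagContactFiltration_of_weight`, p531324).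
* (B2) consumers' shapes: `mem_weightedMonomialIdeal_iff_mem_flagContactFiltration`, **`IsSigmaMaximiser.mem_weightedMonomialIdeal`**
  (the (adm) membership `f ∈ 𝒥_{r₁ν}((x, g₂, g₁); (q, r₂, r₁))` of the σ-flag move, by name), and, in a regular local ring of
  dimension `3`, `flagReaches_of_mem_weightedMonomialIdeal` (membership for an r.s.p. `(x, g₂, g₁)` ⇒ `FlagReaches`).

## References
* J. Włodarczyk, *Functorial resolution except for toroidal locus. Toroidal compactification*, Lemma 2.1.12 (the ideals
  `(u^α : Σ wᵢαᵢ ≥ n)`). [Wlodarczyk2022]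
* H. Hironaka, *Characteristic polyhedra of singularities*, J. Math. Kyoto Univ. 7 (1967), §1. [Hironaka1967]
* res-type-073 `…Iota3Sigma` (p528355); res-type-061 `…P3bDrop` (p529577); res-L1-w43-plan-1 IOTA3-DESIGN v1.3 (OURS, AI planning).
-/

noncomputable section

open IsLocalRing Literature.AlgebraicGeometry.Resolution
open Summit.ResolutionOfSingularities.ResolutionOfSingularities.Theorems

set_option linter.dupNamespace false -- mandated namespace of this single-conjunct summit

namespace Summit.ResolutionOfSingularities.ResolutionOfSingularities.Cruxes.HypersurfaceCentreConstruction.LocalEngine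

namespace Iota3

universe u

variable {S : Type u} [CommRing S]

/-! ## §1 The choice-free filtration is a descending multiplicative filtration -/

section Filtration

variable [IsLocalRing S]

/-- Degree `0` of the two-flag filtration is the unit ideal (the piece `α = β = 0`). [folklore] -/
theorem flagContactFiltration_zero (g₁ g₂ : S) (q r₁ r₂ : ℕ) (hq : 0 < q) :
    flagContactFiltration g₁ g₂ q r₁ r₂ 0 = ⊤ := by
  refine top_le_iff.mp ((le_of_eq ?_).trans (flagPiece_le g₁ g₂ q r₁ r₂ 0 0 0))
  have h0 : (0 - r₁ * 0 - r₂ * 0 + q - 1) / q = 0 := Nat.div_eq_of_lt (by omega)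
  rw [h0, pow_zero, pow_zero, pow_zero, mul_one, mul_one, Ideal.span_singleton_one]

/-- The two-flag filtration is descending in the degree. [folklore] -/
theorem flagContactFiltration_antitone (g₁ g₂ : S) (q r₁ r₂ : ℕ) :
    Antitone (flagContactFiltration g₁ g₂ q r₁ r₂) := by
  intro n n' hnn'
  rw [flagContactFiltration_def, flagContactFiltration_def]
  refine iSup_le fun α => iSup_le fun β => le_iSup_of_le α (le_iSup_of_le β ?_)
  refine Ideal.mul_mono_right (Ideal.pow_le_pow_right (Nat.div_le_div_right ?_))
  omega

/-- **Multiplicativity**: `F a · F b ⊆ F (a + b)` for the two-flag filtration — the pieces multiply (`g`-exponents and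
`𝔪`-exponents add) and the ceilings are subadditive. [folklore] -/
theorem flagContactFiltration_mul_le (g₁ g₂ : S) (q r₁ r₂ : ℕ) (hq : 0 < q) (a b : ℕ) :
    flagContactFiltration g₁ g₂ q r₁ r₂ a * flagContactFiltration g₁ g₂ q r₁ r₂ b ≤
      flagContactFiltration g₁ g₂ q r₁ r₂ (a + b) := by
  rw [flagContactFiltration_def g₁ g₂ q r₁ r₂ a, flagContactFiltration_def g₁ g₂ q r₁ r₂ b, Ideal.iSup_mul]
  refine iSup_le fun α => ?_
  rw [Ideal.iSup_mul]
  refine iSup_le fun β => ?_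
  rw [Ideal.mul_iSup]
  refine iSup_le fun α' => ?_
  rw [Ideal.mul_iSup]
  refine iSup_le fun β' => ?_
  -- the product of the pieces `(α, β)` and `(α', β')` lies in the piece `(α + α', β + β')`
  set k := (a - r₁ * α - r₂ * β + q - 1) / q with hk
  set k' := (b - r₁ * α' - r₂ * β' + q - 1) / q with hk'
  -- `q · ⌈A/q⌉ ≥ A` twice (the ceiling step `Nat.lt_div_mul_add`, kept local: the tree already holds this ℕ-fact under
  -- several names in unrelated modules)
  have hceil : ∀ A : ℕ, A ≤ (A + q - 1) / q * q := fun A => by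
    have h := Nat.lt_div_mul_add (a := A + q - 1) hq
    omega
  have hka : a - r₁ * α - r₂ * β ≤ q * k :=
    calc a - r₁ * α - r₂ * β ≤ (a - r₁ * α - r₂ * β + q - 1) / q * q := hceil _
      _ = q * k := by rw [hk, mul_comm]
  have hkb : b - r₁ * α' - r₂ * β' ≤ q * k' :=
    calc b - r₁ * α' - r₂ * β' ≤ (b - r₁ * α' - r₂ * β' + q - 1) / q * q := hceil _
      _ = q * k' := by rw [hk', mul_comm]
  calc Ideal.span {g₁ ^ α * g₂ ^ β} * maximalIdeal S ^ k * (Ideal.span {g₁ ^ α' * g₂ ^ β'} * maximalIdeal S ^ k')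
      = Ideal.span {g₁ ^ (α + α') * g₂ ^ (β + β')} * maximalIdeal S ^ (k + k') := by
        rw [mul_mul_mul_comm, Ideal.span_singleton_mul_span_singleton, ← pow_add]
        congr 2
        ring
    _ ≤ flagContactFiltration g₁ g₂ q r₁ r₂ (a + b) := by
        refine le_trans (Ideal.mul_mono_right (Ideal.pow_le_pow_right ?_))
          (flagPiece_le g₁ g₂ q r₁ r₂ (a + b) (α + α') (β + β'))
        -- ceiling subadditivity: `⌈(a+b−…)/q⌉ ≤ k + k'`
        rw [Nat.div_le_iff_le_mul_add_pred hq]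
        set K := q * k with hK
        set K' := q * k' with hK'
        have hmul : q * (k + k') = K + K' := by rw [mul_add]
        have : a + b - r₁ * (α + α') - r₂ * (β + β') ≤ K + K' := by
          have e1 : r₁ * (α + α') = r₁ * α + r₁ * α' := by ring
          have e2 : r₂ * (β + β') = r₂ * β + r₂ * β' := by ring
          omega
        rw [hmul]
        omega

end Filtration

/-! ## §2 The bridge -/

section Bridge

variable [IsLocalRing S]

omit [IsLocalRing S] in
/-- If every weight is at least `c`, then `Mᵏ ⊆ 𝒥_{ck}(u; w)` for the ideal `M` generated by `u`. [cite: Wlodarczyk2022, Lemma 2.1.12] -/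
theorem pow_le_weightedMonomialIdeal_mul_of_le_weight {m : ℕ} (u : Fin m → S) (w : Fin m → ℕ) {c : ℕ}
    (hw : ∀ i, c ≤ w i) {M : Ideal S} (hM : Ideal.span (Set.range u) = M) (k : ℕ) :
    M ^ k ≤ weightedMonomialIdeal u w (c * k) := by
  have h1 : M ≤ weightedMonomialIdeal u w c := by
    rw [← hM, Ideal.span_le]
    rintro _ ⟨i, rfl⟩
    exact weightedMonomialIdeal_antitone u w (hw i) (self_mem_weightedMonomialIdeal u w i)
  induction k with
  | zero => rw [pow_zero, Ideal.one_eq_top, mul_zero, weightedMonomialIdeal_zero]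
  | succ k ih =>
    rw [pow_succ, Nat.mul_succ]
    exact (Ideal.mul_mono ih h1).trans (weightedMonomialIdeal_mul_le u w _ _)

omit [IsLocalRing S] in
/-- The product of the completed system `(x, g₂, g₁)` with exponents `(a, b, c)`. [folklore] -/
theorem prod_vec₃_pow (x g₂ g₁ : S) (e : Fin 3 → ℕ) :
    ∏ i, (![x, g₂, g₁] i) ^ e i = x ^ e 0 * g₂ ^ e 1 * g₁ ^ e 2 := by
  rw [Fin.prod_univ_three]
  rfl

/-- **THE BRIDGE.**  If `(x, g₂, g₁)` generates `𝔪` and `0 < q ≤ r₂`, `q ≤ r₁`, then the choice-free two-flag filtration of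
`(g₁, g₂; q, r₁, r₂)` IS the weighted monomial filtration of the full system `(x, g₂, g₁)` with weights `(q, r₂, r₁)`:
`flagContactFiltration g₁ g₂ q r₁ r₂ n = weightedMonomialIdeal ![x, g₂, g₁] ![q, r₂, r₁] n` — any local ring, any completing
generator. [cite: Wlodarczyk2022, Lemma 2.1.12] -/
theorem flagContactFiltration_eq_weightedMonomialIdeal {x g₁ g₂ : S} {q r₁ r₂ : ℕ}
    (h𝔪 : Ideal.span {x, g₂, g₁} = maximalIdeal S) (hq : 0 < q) (hq₂ : q ≤ r₂) (hq₁ : q ≤ r₁) (n : ℕ) :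
    flagContactFiltration g₁ g₂ q r₁ r₂ n = weightedMonomialIdeal ![x, g₂, g₁] ![q, r₂, r₁] n := by
  have hx : x ∈ maximalIdeal S := h𝔪 ▸ Ideal.subset_span (by simp)
  have hrange : Ideal.span (Set.range ![x, g₂, g₁]) = maximalIdeal S := by rw [range_vec₃, h𝔪]
  have hw : ∀ i, q ≤ (![q, r₂, r₁] : Fin 3 → ℕ) i := by
    intro i
    fin_cases i
    · exact le_rfl
    · exact hq₂
    · exact hq₁
  refine le_antisymm ?_ ?_
  · -- `⊆`: piece by piece
    rw [flagContactFiltration_def]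
    refine iSup_le fun α => iSup_le fun β => ?_
    set k := (n - r₁ * α - r₂ * β + q - 1) / q with hk
    have hmono : Ideal.span {g₁ ^ α * g₂ ^ β} ≤ weightedMonomialIdeal ![x, g₂, g₁] ![q, r₂, r₁] (r₁ * α + r₂ * β) := by
      rw [Ideal.span_singleton_le_iff_mem]
      have hwt : r₁ * α + r₂ * β ≤ ∑ i, (![q, r₂, r₁] : Fin 3 → ℕ) i * (![0, β, α] : Fin 3 → ℕ) i := by
        simp only [Fin.sum_univ_three, Matrix.cons_val_zero, Matrix.cons_val_one, Matrix.cons_val_two, Matrix.head_cons,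
          Matrix.tail_cons, mul_zero, zero_add]
        omega
      have h := prod_pow_mem_weightedMonomialIdeal ![x, g₂, g₁] ![q, r₂, r₁] ![0, β, α] hwt
      rw [prod_vec₃_pow] at h
      simp only [Matrix.cons_val_zero, Matrix.cons_val_one, Matrix.cons_val_two, Matrix.head_cons, Matrix.tail_cons,
        pow_zero, one_mul] at h
      rw [mul_comm (g₂ ^ β) (g₁ ^ α)] at h
      exact h
    have hpow : maximalIdeal S ^ k ≤ weightedMonomialIdeal ![x, g₂, g₁] ![q, r₂, r₁] (q * k) :=
      pow_le_weightedMonomialIdeal_mul_of_le_weight _ _ hw hrange k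
    refine (Ideal.mul_mono hmono hpow).trans ((weightedMonomialIdeal_mul_le _ _ _ _).trans
      (weightedMonomialIdeal_antitone _ _ ?_))
    have hka : n - r₁ * α - r₂ * β ≤ q * k := by
      have h := Nat.lt_div_mul_add (a := n - r₁ * α - r₂ * β + q - 1) hq
      calc n - r₁ * α - r₂ * β ≤ (n - r₁ * α - r₂ * β + q - 1) / q * q := by omega
        _ = q * k := by rw [hk, mul_comm]
    set K := q * k with hK
    omega
  · -- `⊇`: generator by generator
    unfold weightedMonomialIdeal
    rw [Ideal.span_le]
    rintro _ ⟨e, he, rfl⟩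
    rw [SetLike.mem_coe, prod_vec₃_pow]
    have h := mul_mem_flagContactFiltration_of_weight (g₁ := g₁) (g₂ := g₂) (r₁ := r₁) (r₂ := r₂) (n := n)
      (α := e 2) (β := e 1) (k := e 0) (c := x ^ e 0) hq (Ideal.pow_mem_pow hx _) ?_
    · simpa [mul_comm, mul_left_comm, mul_assoc] using h
    · simp only [Fin.sum_univ_three, Matrix.cons_val_zero, Matrix.cons_val_one, Matrix.cons_val_two,
        Matrix.head_cons, Matrix.tail_cons] at he
      linarith

/-- Membership form of the bridge. [folklore] -/
theorem mem_weightedMonomialIdeal_iff_mem_flagContactFiltration {x g₁ g₂ f : S} {q r₁ r₂ : ℕ}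
    (h𝔪 : Ideal.span {x, g₂, g₁} = maximalIdeal S) (hq : 0 < q) (hq₂ : q ≤ r₂) (hq₁ : q ≤ r₁) (n : ℕ) :
    f ∈ weightedMonomialIdeal ![x, g₂, g₁] ![q, r₂, r₁] n ↔ f ∈ flagContactFiltration g₁ g₂ q r₁ r₂ n := by
  rw [flagContactFiltration_eq_weightedMonomialIdeal h𝔪 hq hq₂ hq₁ n]

end Bridge

section Maximiser

variable {S₀ : Type} [CommRing S₀] [IsLocalRing S₀]

/-- **(adm) for the σ-flag move, by name**: a σ-attaining two-flag `(g₁, g₂; q, r₁, r₂)` of `f` (order `ν`) completed by ANY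
`x` with `(x, g₂, g₁) = 𝔪` has `f ∈ 𝒥_{r₁ν}((x, g₂, g₁); (q, r₂, r₁))` — the admissibility membership of the move
`u = ![x, g₂, g₁]`, `w = ![q, r₂, r₁]` of `Iota3.P3bDropOf` (res-type-061's `IsSigmaMaximiser` lives in `Type`).
[OURS · L1 W4.3 · P3 rung] -/
theorem IsSigmaMaximiser.mem_weightedMonomialIdeal {f : S₀} {ν : ℕ} {x g₁ g₂ : S₀} {q r₁ r₂ : ℕ}
    (h : IsSigmaMaximiser f ν g₁ g₂ q r₁ r₂) (h𝔪 : Ideal.span {x, g₂, g₁} = maximalIdeal S₀) :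
    f ∈ weightedMonomialIdeal ![x, g₂, g₁] ![q, r₂, r₁] (r₁ * ν) := by
  rw [mem_weightedMonomialIdeal_iff_mem_flagContactFiltration h𝔪 h.1.1 h.1.2.1 (h.1.2.1.trans h.1.2.2)]
  exact h.2.2.1

end Maximiser

/-! ## §3 Regular local rings of dimension three: membership ⇒ `FlagReaches` -/

section Reaches

variable {T : Type u} [CommRing T] [IsRegularLocalRing T]

/-- In a regular local ring of dimension `3` with regular system `(x, g₂, g₁)`: membership of `f` in level `r₁ν` of the
weighted monomial filtration with admissible weights `(q, r₂, r₁)` exhibits the two-flag `(g₁, g₂)` reaching `(q; r₁, r₂)`.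
[OURS · L1 W4.3 · P3 rung] -/
theorem flagReaches_of_mem_weightedMonomialIdeal (hdim : ringKrullDim T = 3) {x g₁ g₂ f : T} {q r₁ r₂ ν : ℕ}
    (h𝔪 : Ideal.span {x, g₂, g₁} = maximalIdeal T) (hq : 0 < q) (hq₂ : q ≤ r₂) (hq₁ : q ≤ r₁)
    (hf : f ∈ weightedMonomialIdeal ![x, g₂, g₁] ![q, r₂, r₁] (r₁ * ν)) : FlagReaches f ν q r₁ r₂ := by
  refine ⟨g₁, g₂, ((isTwoFlag_of_span_triple_eq hdim h𝔪).2.2).symm, ?_⟩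
  rwa [← mem_weightedMonomialIdeal_iff_mem_flagContactFiltration h𝔪 hq hq₂ hq₁]

end Reaches

/-! ## §4 Dominance: a flag inside another flag's filtration gives a smaller filtration (rev 2) -/

section Dominance

variable [IsLocalRing S]

/-- Powers of a level: `F(a)ʲ ⊆ F(a·j)`. [folklore] -/
theorem pow_le_flagContactFiltration_mul (g₁ g₂ : S) {q : ℕ} (r₁ r₂ : ℕ) (hq : 0 < q) (a j : ℕ) :
    flagContactFiltration g₁ g₂ q r₁ r₂ a ^ j ≤ flagContactFiltration g₁ g₂ q r₁ r₂ (a * j) := by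
  induction j with
  | zero => rw [pow_zero, mul_zero, flagContactFiltration_zero g₁ g₂ q r₁ r₂ hq, Ideal.one_eq_top]
  | succ j ih =>
    rw [pow_succ, Nat.mul_succ]
    exact (Ideal.mul_mono ih le_rfl).trans (flagContactFiltration_mul_le g₁ g₂ q r₁ r₂ hq _ _)

/-- `𝔪 ⊆ F(q)` (every element of `𝔪` has weight `≥ 1 = q/q`). [folklore] -/
theorem maximalIdeal_le_flagContactFiltration (g₁ g₂ : S) {q : ℕ} (r₁ r₂ : ℕ) (hq : 0 < q) :
    maximalIdeal S ≤ flagContactFiltration g₁ g₂ q r₁ r₂ q := fun c hc =>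
  mem_flagContactFiltration_of_mem_pow (g₁ := g₁) (g₂ := g₂) (r₁ := r₁) (r₂ := r₂) (k := 1) hq
    (by rwa [pow_one]) (by rw [mul_one])

/-- **Dominance.** If the members of a second pair `(g₁′, g₂′)` lie in the levels `r₁`, `r₂` of the filtration of `(g₁, g₂)` (same
weights), then the whole filtration of `(g₁′, g₂′)` lies in that of `(g₁, g₂)`, level by level: every piece
`(g₁′^α g₂′^β)·𝔪ᵏ` sits in `F(r₁)^α F(r₂)^β F(q)^k ⊆ F(r₁α + r₂β + qk) ⊆ F(n)`.  The first half of every canonicity / flag-change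
argument for the σ-letters and `jSigmaPt` ((J-can)). [folklore] -/
theorem flagContactFiltration_le_of_mem {g₁ g₂ g₁' g₂' : S} {q r₁ r₂ : ℕ} (hq : 0 < q)
    (h₁ : g₁' ∈ flagContactFiltration g₁ g₂ q r₁ r₂ r₁) (h₂ : g₂' ∈ flagContactFiltration g₁ g₂ q r₁ r₂ r₂) (n : ℕ) :
    flagContactFiltration g₁' g₂' q r₁ r₂ n ≤ flagContactFiltration g₁ g₂ q r₁ r₂ n := by
  rw [flagContactFiltration_def g₁' g₂']
  refine iSup_le fun α => iSup_le fun β => ?_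
  set k := (n - r₁ * α - r₂ * β + q - 1) / q with hk
  have hka : n - r₁ * α - r₂ * β ≤ q * k := by
    have h := Nat.lt_div_mul_add (a := n - r₁ * α - r₂ * β + q - 1) hq
    calc n - r₁ * α - r₂ * β ≤ (n - r₁ * α - r₂ * β + q - 1) / q * q := by omega
      _ = q * k := by rw [hk, mul_comm]
  -- the three factors
  have hA : Ideal.span {g₁' ^ α * g₂' ^ β} ≤ flagContactFiltration g₁ g₂ q r₁ r₂ (r₁ * α + r₂ * β) := by
    rw [Ideal.span_singleton_le_iff_mem]
    have hα : g₁' ^ α ∈ flagContactFiltration g₁ g₂ q r₁ r₂ (r₁ * α) :=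
      pow_le_flagContactFiltration_mul g₁ g₂ r₁ r₂ hq r₁ α (Ideal.pow_mem_pow h₁ α)
    have hβ : g₂' ^ β ∈ flagContactFiltration g₁ g₂ q r₁ r₂ (r₂ * β) :=
      pow_le_flagContactFiltration_mul g₁ g₂ r₁ r₂ hq r₂ β (Ideal.pow_mem_pow h₂ β)
    exact flagContactFiltration_mul_le g₁ g₂ q r₁ r₂ hq _ _ (Ideal.mul_mem_mul hα hβ)
  have hB : maximalIdeal S ^ k ≤ flagContactFiltration g₁ g₂ q r₁ r₂ (q * k) :=
    (Ideal.pow_right_mono (maximalIdeal_le_flagContactFiltration g₁ g₂ r₁ r₂ hq) k).trans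
      (pow_le_flagContactFiltration_mul g₁ g₂ r₁ r₂ hq q k)
  refine (Ideal.mul_mono hA hB).trans ((flagContactFiltration_mul_le g₁ g₂ q r₁ r₂ hq _ _).trans
    (flagContactFiltration_antitone g₁ g₂ q r₁ r₂ ?_))
  set K := q * k with hK
  omega

/-- Mutual dominance gives EQUAL filtrations. [folklore] -/
theorem flagContactFiltration_eq_of_mem_of_mem {g₁ g₂ g₁' g₂' : S} {q r₁ r₂ : ℕ} (hq : 0 < q)
    (h₁ : g₁' ∈ flagContactFiltration g₁ g₂ q r₁ r₂ r₁) (h₂ : g₂' ∈ flagContactFiltration g₁ g₂ q r₁ r₂ r₂)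
    (h₁' : g₁ ∈ flagContactFiltration g₁' g₂' q r₁ r₂ r₁) (h₂' : g₂ ∈ flagContactFiltration g₁' g₂' q r₁ r₂ r₂) (n : ℕ) :
    flagContactFiltration g₁' g₂' q r₁ r₂ n = flagContactFiltration g₁ g₂ q r₁ r₂ n :=
  le_antisymm (flagContactFiltration_le_of_mem hq h₁ h₂ n) (flagContactFiltration_le_of_mem hq h₁' h₂' n)

/-- The generators themselves lie in their levels: `g₁ ∈ F(r₁)`, `g₂ ∈ F(r₂)` (so dominance is reflexive). [folklore] -/
theorem self_mem_flagContactFiltration (g₁ g₂ : S) {q : ℕ} (r₁ r₂ : ℕ) (hq : 0 < q) :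
    g₁ ∈ flagContactFiltration g₁ g₂ q r₁ r₂ r₁ ∧ g₂ ∈ flagContactFiltration g₁ g₂ q r₁ r₂ r₂ := by
  constructor
  · have h := pow_left_mem_flagContactFiltration (g₁ := g₁) (g₂ := g₂) (r₁ := r₁) (r₂ := r₂) (n := r₁) (α := 1) hq
      (by rw [mul_one])
    rwa [pow_one] at h
  · have h := pow_right_mem_flagContactFiltration (g₁ := g₁) (g₂ := g₂) (r₁ := r₁) (r₂ := r₂) (n := r₂) (β := 1) hq
      (by rw [mul_one])
    rwa [pow_one] at h

end Dominance

end Iota3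

end Summit.ResolutionOfSingularities.ResolutionOfSingularities.Cruxes.HypersurfaceCentreConstruction.LocalEngine

end
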